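import Summits.CriticalPhenomena.PercolationContinuityZ3.Theorems.Transplant.SkelPhiLinkedSide
import Summits.CriticalPhenomena.PercolationContinuityZ3.Theorems.Transplant.KNLevelsStepIV
import Summits.CriticalPhenomena.PercolationContinuityZ3.Theorems.Transplant.UniqZoneGeneric
import HarnessLib

/-!
# D″ node, STRUCTURE-FREE layer L5′.3, part 1 (V98 p3 column; P4-GENERAL §16.2 (i), §16.6; DPRIME-SCOPE p3 addendum L.4): STEP I′ — the
# θ-dependent INPUT FAMILY of route D″ v2 as an explicit finite family of cylinder events, indexed WITHOUT `HOct 2`: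
# the uniqueness zone of the fat prisms at a base vertex, and the links from the seed `fatSeq t (msel t)` to the four SIDE-HALVES of the
# BAND RECTANGLE of every extent `ℓ` along each axis `i` (half-widths `bandWidths Gb Fb i ℓ = (ℓ, Gb ℓ)` / `(Fb ℓ, ℓ)`, certified inside the fat
# rectangle `rectPrism t a (ψ (amax a))`) — φ-level re-type of `SkelScales` §2 (definitions, locality, unpacking); the certification at `p`
# (Step I′ proper, from LEVEL 0 + `SkelPhiLinkedSide`) is part 2

builds on p205010 (kernel theorem, internal audit signed; external expert review pending) — nothing in this file uses p205010.
Lane `prim-bschramm`, seat `prim-bschramm-p3` (gen 7; D″ design owner); helper file (`--supports stmt-CriticalPhenomena-4575`).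
Data of the family (fixed at the reference density by part 2, ARGUMENTS here and downstream — K2.3/F2): the seed scales `msel : V → ℕ`, the fat
radius through `(hfr, hC)`, and the band inputs `Gb Fb : ℕ → ℕ` (type-envelopes of `bandG` / `bandFinv`, F1).  Consumers: the two-scale Step-IV kit
(`KNLevels.stepIV_out`, kit extent `M_u + 1 ∈ Sx ∩ Sy`), the LEVEL-1 chains (extents in `[e − R′, 2e + R′] ⊆ Sx`, …), the `p ↦ q₀` transfer
(`SameP.abs_real_sub_real_le` on `inputIndex`).
* §1 `bandWidths Gb Fb i ℓ` (+ `_self`, `_oth`), `Idx V := V × ℕ × Option (Fin 2 × ℤˣ × ℤˣ)`;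
* §2 **`inputEvent hfr hC msel Gb Fb : Idx V → Set (BondConfig V)`** (`none` ↦ zone, `some (i, σ, τ)` ↦ link to the side-half), `inputScale`, `inputEdges`,
  **`determinedBy_inputEvent`** (every input is a cylinder event on the pairs inside one fat prism), `measurableSet_inputEvent`;
* §3 **`inputIndex types Sz Sx Sy`**, `mem_inputIndex_none / _zero / _one`, **`hstd_of_inputs`** (unpacking at a running density `q`: zone at every
  `M ∈ Sz`, x-halves at every `ℓ ∈ Sx`, y-halves at every `ℓ ∈ Sy`, every base vertex), `link_rside_of_inputs` (sides from halves).
[cite: KozmaNitzan2024, §4 p. 17 (Step I: the scales m, M), Lemma 7 (p. 15), Lemma 9 (p. 16), p. 16 (hittable geometries are events of finite boxes)]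
-/

noncomputable section

open MeasureTheory

namespace Summit.CriticalPhenomena.PercolationContinuityZ3.Theorems.Transplant

namespace Skelφ

open Literature.Probability.Percolation Literature.Probability.LatticeModels SimpleGraph KNLevels
open Literature.Probability.Percolation.KozmaNitzan.Cells (oth oth_ne oth_oth eq_oth_of_ne)
open scoped Classical

variable {V : Type} [DecidableEq V] {G : SimpleGraph V} [G.LocallyFinite] {φ : V → Site 2} {types : Finset V}

/-! ## §1 Band half-widths and the index type -/

omit [DecidableEq V] [G.LocallyFinite] in
/-- **The half-widths of the band rectangle of extent `ℓ` along axis `i`**: `(ℓ, Gb ℓ)` for `i = 0` (an x-step of extent `ℓ` spreads `Gb ℓ` in `y`),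
`(Fb ℓ, ℓ)` for `i = 1`. [cite: KozmaNitzan2024, §4 p. 16 (the hittable geometry (F, Q))] -/
def bandWidths (Gb Fb : ℕ → ℕ) (i : Fin 2) (ℓ : ℕ) : Fin 2 → ℕ := fun j => if j = i then ℓ else if i = 0 then Gb ℓ else Fb ℓ

omit [DecidableEq V] [G.LocallyFinite] in
/-- The extent coordinate. [folklore] -/
@[simp] theorem bandWidths_self (Gb Fb : ℕ → ℕ) (i : Fin 2) (ℓ : ℕ) : bandWidths Gb Fb i ℓ i = ℓ := by simp [bandWidths]

omit [DecidableEq V] [G.LocallyFinite] in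
/-- The transverse coordinate for `i = 0`. [folklore] -/
@[simp] theorem bandWidths_zero_one (Gb Fb : ℕ → ℕ) (ℓ : ℕ) : bandWidths Gb Fb 0 ℓ 1 = Gb ℓ := by simp [bandWidths]

omit [DecidableEq V] [G.LocallyFinite] in
/-- The transverse coordinate for `i = 1`. [folklore] -/
@[simp] theorem bandWidths_one_zero (Gb Fb : ℕ → ℕ) (ℓ : ℕ) : bandWidths Gb Fb 1 ℓ 0 = Fb ℓ := by simp [bandWidths]

omit [DecidableEq V] [G.LocallyFinite] in
/-- The extent is at most the larger half-width. [folklore] -/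
theorem le_amax_bandWidths (Gb Fb : ℕ → ℕ) (i : Fin 2) (ℓ : ℕ) : ℓ ≤ amax (bandWidths Gb Fb i ℓ) := by
  have := le_amax (bandWidths Gb Fb i ℓ) i
  rwa [bandWidths_self] at this

/-- The index type of the input family: base vertex × scale/extent × (`none` = zone | `some (axis, side sign, half sign)`). [this work] -/
abbrev Idx (V : Type) := V × ℕ × Option (Fin 2 × ℤˣ × ℤˣ)

/-! ## §2 The input events -/

section Events

variable [Countable V] (hfr : Frames G φ types) {p : unitInterval} (hC : CylSubcritical G φ types p) (msel : V → ℕ) (Gb Fb : ℕ → ℕ)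

/-- **The input events of route D″ v2**: the uniqueness zone of the fat prisms at `t` between `msel t` and `M` (`none`), and the link from the
seed `fatSeq t (msel t)` to the side-half `(i, σ, τ)` of the band rectangle of extent `ℓ`, inside its fat rectangle (`some (i, σ, τ)`).
[cite: KozmaNitzan2024, §4 Lemma 7 (p. 15), Lemma 9 (p. 16)] -/
def inputEvent : Idx V → Set (BondConfig V)
  | (t, M, none) => UniqZone.zone G (fatSeq hfr hC t) (msel t) M
  | (t, ℓ, some (i, σ, τ)) =>
      linkIn (rectPrism G φ t (bandWidths Gb Fb i ℓ) (fatRadius hfr hC (amax (bandWidths Gb Fb i ℓ)))) (fatSeq hfr hC t (msel t))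
        (rhalf G φ t (bandWidths Gb Fb i ℓ) (fatRadius hfr hC (amax (bandWidths Gb Fb i ℓ))) i (σ : ℤ) (τ : ℤ))

omit [DecidableEq V] [G.LocallyFinite] [Countable V] in
/-- The planar scale of the fat prism carrying an input: `M` for the zone, `amax (bandWidths i ℓ)` for a link. [folklore] -/
def inputScale : Idx V → ℕ
  | (_, M, none) => M
  | (_, ℓ, some (i, _, _)) => amax (bandWidths Gb Fb i ℓ)

/-- **The finite edge support** of an input event: the off-diagonal pairs inside the fat prism of its scale. [folklore] -/
def inputEdges (i : Idx V) : Finset (Sym2 V) := pairsF (fatSeq hfr hC i.1 (inputScale Gb Fb i))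

/-- The zone input, unfolded. [folklore] -/
@[simp] theorem inputEvent_none (t : V) (M : ℕ) :
    inputEvent hfr hC msel Gb Fb (t, M, none) = UniqZone.zone G (fatSeq hfr hC t) (msel t) M := rfl

/-- The link input, unfolded. [folklore] -/
@[simp] theorem inputEvent_some (t : V) (ℓ : ℕ) (i : Fin 2) (σ τ : ℤˣ) :
    inputEvent hfr hC msel Gb Fb (t, ℓ, some (i, σ, τ)) =
      linkIn (rectPrism G φ t (bandWidths Gb Fb i ℓ) (fatRadius hfr hC (amax (bandWidths Gb Fb i ℓ)))) (fatSeq hfr hC t (msel t))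
        (rhalf G φ t (bandWidths Gb Fb i ℓ) (fatRadius hfr hC (amax (bandWidths Gb Fb i ℓ))) i (σ : ℤ) (τ : ℤ)) := rfl

omit [DecidableEq V] in
/-- The fat rectangle of a link input lies in the fat prism of its scale. [folklore] -/
theorem rectPrism_subset_fatSeq (t : V) (a : Fin 2 → ℕ) :
    rectPrism G φ t a (fatRadius hfr hC (amax a)) ⊆ ↑(fatSeq hfr hC t (amax a)) := by
  intro w hw
  rw [Finset.mem_coe, mem_fatSeq_iff]
  exact rectPrism_subset_cylBall G φ t a _ hw

/-- **Every input event is determined by the pairs inside its fat prism** (a cylinder event on finitely many coordinates — this is what makes the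
`p ↦ q₀` transfer a matter of continuity). [cite: KozmaNitzan2024, §4 p. 16 (hittable geometries are events of finite boxes)] -/
theorem determinedBy_inputEvent (i : Idx V) :
    DeterminedBy (inputEvent hfr hC msel Gb Fb i) (↑(inputEdges hfr hC Gb Fb i) : Set (Sym2 V)) := by
  obtain ⟨t, M, og⟩ := i
  rcases og with _ | ⟨ax, σ, τ⟩
  · exact determinedBy_zone _ _ _ (by rw [inputEdges, inputScale, coe_pairsF])
  · refine determinedBy_linkIn _ _ _ ?_
    rw [inputEdges, inputScale, coe_pairsF]
    exact KozmaNitzan.wireSet_mono (rectPrism_subset_fatSeq hfr hC t _)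

/-- Input events are measurable. [folklore] -/
theorem measurableSet_inputEvent (i : Idx V) : MeasurableSet (inputEvent hfr hC msel Gb Fb i) :=
  (determinedBy_inputEvent hfr hC msel Gb Fb i).measurableSet_of_finset

end Events

/-! ## §3 The finite index set and the unpacking at a running density -/

omit [DecidableEq V] [G.LocallyFinite] in
/-- **The finite index set** of the inputs: base vertices × (zone scales `Sz` | x-extents `Sx` × signs | y-extents `Sy` × signs). [folklore] -/
def inputIndex (types : Finset V) (Sz Sx Sy : Finset ℕ) : Finset (Idx V) :=
  types ×ˢ ((Sz ×ˢ ({none} : Finset (Option (Fin 2 × ℤˣ × ℤˣ)))) ∪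
    (Sx ×ˢ ((Finset.univ : Finset (ℤˣ × ℤˣ)).image fun στ => some ((0 : Fin 2), στ))) ∪
    (Sy ×ˢ ((Finset.univ : Finset (ℤˣ × ℤˣ)).image fun στ => some ((1 : Fin 2), στ))))

omit [DecidableEq V] [G.LocallyFinite] in
/-- Zone indices. [folklore] -/
theorem mem_inputIndex_none {Sz Sx Sy : Finset ℕ} {t : V} (ht : t ∈ types) {M : ℕ} (hM : M ∈ Sz) :
    (t, M, none) ∈ inputIndex types Sz Sx Sy := by
  simp only [inputIndex, Finset.mem_product, Finset.mem_union, Finset.mem_singleton]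
  exact ⟨ht, Or.inl (Or.inl ⟨hM, trivial⟩)⟩

omit [DecidableEq V] [G.LocallyFinite] in
/-- x-link indices. [folklore] -/
theorem mem_inputIndex_zero {Sz Sx Sy : Finset ℕ} {t : V} (ht : t ∈ types) {ℓ : ℕ} (hℓ : ℓ ∈ Sx) (σ τ : ℤˣ) :
    (t, ℓ, some (0, σ, τ)) ∈ inputIndex types Sz Sx Sy := by
  simp only [inputIndex, Finset.mem_product, Finset.mem_union, Finset.mem_image, Finset.mem_univ, true_and]
  exact ⟨ht, Or.inl (Or.inr ⟨hℓ, (σ, τ), rfl⟩)⟩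

omit [DecidableEq V] [G.LocallyFinite] in
/-- y-link indices. [folklore] -/
theorem mem_inputIndex_one {Sz Sx Sy : Finset ℕ} {t : V} (ht : t ∈ types) {ℓ : ℕ} (hℓ : ℓ ∈ Sy) (σ τ : ℤˣ) :
    (t, ℓ, some (1, σ, τ)) ∈ inputIndex types Sz Sx Sy := by
  simp only [inputIndex, Finset.mem_product, Finset.mem_union, Finset.mem_image, Finset.mem_univ, true_and]
  exact ⟨ht, Or.inr ⟨hℓ, (σ, τ), rfl⟩⟩

omit [DecidableEq V] [G.LocallyFinite] in
/-- The base vertex of an index is a base vertex. [folklore] -/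
theorem fst_mem_of_mem_inputIndex {Sz Sx Sy : Finset ℕ} {i : Idx V} (hi : i ∈ inputIndex types Sz Sx Sy) : i.1 ∈ types :=
  (Finset.mem_product.1 hi).1

section Unpack

variable [Countable V] (hfr : Frames G φ types) {p : unitInterval} (hC : CylSubcritical G φ types p) (msel : V → ℕ) (Gb Fb : ℕ → ℕ)

/-- **Unpacking the inputs at a running density `q`**: if every input over `inputIndex types Sz Sx Sy` has probability `> 1 − δ` at `q`, then at every
base vertex: the zone holds at every `M ∈ Sz`, and the four halves of the band rectangle of every extent `ℓ ∈ Sx` (axis `0`) / `ℓ ∈ Sy` (axis `1`) are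
linked from the seed inside the fat rectangle — each with probability `> 1 − δ` (the `h1`/`h2` shapes of `KNLevels.stepIV_out` and of the chain steps).
[cite: KozmaNitzan2024, §4 p. 17 (Step I)] -/
theorem hstd_of_inputs {Sz Sx Sy : Finset ℕ} {q : unitInterval} {δ : ℝ}
    (h : ∀ i ∈ inputIndex types Sz Sx Sy, 1 - δ < (bondPercolation G q).real (inputEvent hfr hC msel Gb Fb i)) {t : V} (ht : t ∈ types) :
    (∀ M ∈ Sz, 1 - δ < (bondPercolation G q).real (UniqZone.zone G (fatSeq hfr hC t) (msel t) M)) ∧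
      (∀ ℓ ∈ Sx, ∀ σ τ : ℤˣ, 1 - δ < (bondPercolation G q).real
        (linkIn (rectPrism G φ t (bandWidths Gb Fb 0 ℓ) (fatRadius hfr hC (amax (bandWidths Gb Fb 0 ℓ)))) (fatSeq hfr hC t (msel t))
          (rhalf G φ t (bandWidths Gb Fb 0 ℓ) (fatRadius hfr hC (amax (bandWidths Gb Fb 0 ℓ))) 0 (σ : ℤ) (τ : ℤ)))) ∧
      (∀ ℓ ∈ Sy, ∀ σ τ : ℤˣ, 1 - δ < (bondPercolation G q).real
        (linkIn (rectPrism G φ t (bandWidths Gb Fb 1 ℓ) (fatRadius hfr hC (amax (bandWidths Gb Fb 1 ℓ)))) (fatSeq hfr hC t (msel t))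
          (rhalf G φ t (bandWidths Gb Fb 1 ℓ) (fatRadius hfr hC (amax (bandWidths Gb Fb 1 ℓ))) 1 (σ : ℤ) (τ : ℤ)))) :=
  ⟨fun _ hM => h _ (mem_inputIndex_none ht hM),
    fun _ hℓ σ τ => h _ (mem_inputIndex_zero ht hℓ σ τ),
    fun _ hℓ σ τ => h _ (mem_inputIndex_one ht hℓ σ τ)⟩

omit [DecidableEq V] [Countable V] in
/-- **Directed sides from halves**: a link to a side-half is a link to the side (`rhalf ⊆ rside`), so the inputs also bound the directed-side events
the Step-IV kit uses as relay face. [folklore] -/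
theorem real_linkIn_rside_ge_rhalf (q : unitInterval) (t : V) (a : Fin 2 → ℕ) (R : ℕ) (B : Finset V) (i : Fin 2) (σ τ : ℤ) :
    (bondPercolation G q).real (linkIn (rectPrism G φ t a R) B (rhalf G φ t a R i σ τ)) ≤
      (bondPercolation G q).real (linkIn (rectPrism G φ t a R) B (rside G φ t a R i σ)) :=
  measureReal_mono (linkIn_mono subset_rfl subset_rfl (rhalf_subset G φ t a R i σ τ)) (measure_ne_top _ _)

end Unpack

end Skelφ

end Summit.CriticalPhenomena.PercolationContinuityZ3.Theorems.Transplant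

end
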